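/-
Copyright: the b2b-balaban T⁴-continuum CRUX team, row NE7b leaf lineage `t4-ne7b-formalise-leaf-01` (gen 83). Project licence.
-/
import Mathlib.Analysis.Calculus.Taylor
import Mathlib.Analysis.Calculus.IteratedDeriv.Lemmas
import Mathlib.Analysis.Calculus.ContDiff.Basic
import Mathlib.Algebra.Order.Field.GeomSum

/-!
# POWER COUNTING OF THE INHERITED HESSIAN LETTERS: a kernel with no constant term (transversality) and no odd terms
# (reflection symmetry) is `O(‖p‖²)` — MARGINAL under the dimension-two rescaling, `k + 1` equal terms —, and after the
# quadratic (marginal) part is subtracted it is `O(‖p‖⁴)` — IRRELEVANT, the scale sum is geometric and UNIFORM IN `k`;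
# the subtracted marginal parts renormalise the coefficient of the main form (row NE7b, node U5c; kernel lemmas of calculus)

Cell `pub-balaban`, sub-cell `t4`, spine estimate NE7b (`T4WeightBudget.RelWeightBound`; the cell's OWN estimate — NOT PRINTED in
[Bałaban 1983–89], NOT PROVED).  Crux-route work under `Spine/NE7b/` by a row leaf on the windowed convexity road (R-P1); NOTHING of
Bałaban's is named as a Lean object, valued or asserted; no `T4Continuum/Support` leaf typed; no `def`; zero `sorry`.  Imports: Mathlib
only — independent of the hub's olean frontier.

WHY.  The road's by-value debt (i) (PRICING-NE7b v104 §3¹⁰⁴) is the (A3) display — a uniform-in-`k` Hessian letter for the effective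
action on print's window.  Its POLYMER part was LOCATED by the refuter (R-AHL-g83-1 (c), adopted by leaf-06 g150 into the NOT-HERE of
`…AnalyticHessianLetterLocal` v3, l.56965): a sup-norm ∕ Cauchy letter on the UNSUBTRACTED terms inherited from the scales `j ≤ k` is
the power counting of a MASS INSERTION — relatively `O(L^{2(k−j)})` per scale, not summable —; print never pays it because gauge
invariance ([B12] (1.19), the Ward identity) kills the mass term and the explicit `−β_{j+1}(g_j)·A(U_k)` counter-terms ((1.3),
(0.22)–(0.23), (1.20)–(1.22)) cancel the marginal part scale by scale, leaving an irrelevant `O(L^{−2(k−j)})` remainder; «the missing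
input is a cancellation, not a number» (NEEDS-CONSTANT 0).  THIS FILE types that cancellation mechanism IN SHAPE, as [folklore] calculus
and bookkeeping, so that the road can DISPLAY exactly what it consumes: (W) no constant term, (R) no odd terms, (S) the quadratic part
subtracted into the running coefficient, (D) a fourth-derivative letter per inherited kernel — and then the inherited sum is bounded
uniformly in `k` by a geometric series, with the window radius `ρ` squared in front.

WHAT IS PROVED ([folklore]; Mathlib's `taylor_mean_remainder_bound`, `iteratedDeriv_comp_neg`,
`ContinuousLinearMap.iteratedFDeriv_comp_right`, `geom_sum_Ico_le_of_lt_one` BY NAME):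
* §1 TRANSVERSALITY KILLS THE MASS TERM (`E`, `G` real normed spaces, `Φ : E → E →L[ℝ] G` continuous at `0`):
  `apply_zero_eq_zero_of_transversal` — `(∀ p, Φ p p = 0) ⟹ Φ 0 = 0` (the longitudinal direction is a zero mode at every momentum,
  hence NO polarisation has a mass term; `G` arbitrary, so form-valued kernels are covered).
* §2 REFLECTION SYMMETRY KILLS THE ODD ORDERS (one real variable, `g : ℝ → G`): `iteratedDeriv_eq_zero_of_even_of_odd`
  (`g(−t) = g(t)`, `n` odd ⟹ `g⁽ⁿ⁾(0) = 0`), `deriv_eq_zero_of_even`.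
* §3 THE RAY LETTERS (Taylor at `0` along `[0,1]`, `g` even with `g 0 = 0`): MARGINAL `norm_le_of_even` (`g ∈ C²`, `‖g″‖ ≤ M₂` on
  `[0,1]` ⟹ `‖g 1‖ ≤ M₂`) and SUBTRACTED `norm_sub_half_iteratedDeriv_two_le_of_even` (`g ∈ C⁴`, `‖g⁗‖ ≤ M₄` on `[0,1]` ⟹
  `‖g 1 − ½·g″(0)‖ ≤ M₄ ∕ 6`).
* §4 THE KERNEL LETTERS (several variables, `Φ : E → G` even, `Φ 0 = 0`, along the ray `t ↦ Φ(t•p)`: `iteratedDeriv_ray`):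
  `norm_le_of_iteratedFDeriv_two_le` (`‖D²Φ‖ ≤ K₂` on `closedBall 0 ρ` ⟹ `‖Φ p‖ ≤ K₂‖p‖²` for `‖p‖ ≤ ρ`) and
  `norm_sub_half_hessian_le_of_iteratedFDeriv_four_le` (`‖D⁴Φ‖ ≤ K₄` ⟹ `‖Φ p − ½·D²Φ(0)[p,…,p]‖ ≤ (K₄∕6)‖p‖⁴`).
* §5 THE DIMENSION-TWO RESCALING AND THE THREE REGIMES.  The age-`n` letter of a kernel `Φ` read at the current scale is
  `(Lⁿ)² • Φ((Lⁿ)⁻¹ • p)` (written inline; `L ≥ 1`): `norm_rescaled_le` (`‖Φ q‖ ≤ C‖q‖ᵐ` on `‖q‖ ≤ ρ` ⟹ the age-`n` letter is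
  `≤ C‖p‖ᵐ·(Lⁿ)²∕(Lⁿ)ᵐ`), whence RELEVANT `m = 0` (`≤ C·(Lⁿ)²`, attained by a constant kernel: `rescaled_const`), MARGINAL `m = 2`
  (`norm_rescaled_le_of_sq`: `≤ C‖p‖²` at EVERY age; `sum_norm_rescaled_le_of_sq`: `k + 1` such terms, `≤ (k+1)·C‖p‖²` — the
  logarithm of the cutoff), IRRELEVANT `m = 4` (`norm_rescaled_le_of_fourth`: `≤ C ρ² ‖p‖² ∕ (L²)ⁿ`; **`sum_norm_rescaled_le_of_fourth`**:
  `Σ_{n ≤ k} ≤ C ρ² (L²∕(L²−1)) ‖p‖²` for `L > 1`, UNIFORMLY IN `k`).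
* §6 THE RENORMALISED FLOOR (scalar currency).  `sum_rescaled_split` — if the age-`n` kernel is `bₙ·m + Rₙ` with `m` 2-homogeneous
  (`m(c•q) = c²·m(q)`), the inherited sum is `(Σ_{n≤k} bₙ)·m(p) + Σ_{n≤k} (Lⁿ)²Rₙ((Lⁿ)⁻¹p)`: the marginal parts RENORMALISE THE
  COEFFICIENT of the main form (`a_k = a₀ + Σ_{n≤k} bₙ`, the running inverse coupling in shape) and only the subtracted remainders are
  summed; **`floor_uniform_of_running_coefficient`** — with `μ‖p‖² ≤ m(p)`, `|Rₙ q| ≤ C‖q‖⁴` on `‖q‖ ≤ ρ` and the DISPLAYED letter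
  `a_min ≤ a_k` (`0 ≤ a_min`): `(a_min·μ − Cρ²·L²∕(L²−1))·‖p‖² ≤ a_k·m(p) + Σ_{n≤k} (Lⁿ)²Rₙ((Lⁿ)⁻¹p)` for every `k` and `‖p‖ ≤ ρ`;
  `floor_uniform_of_split` composes the two.
* §7 toys: the constant kernel is exactly relevant, the pure quadratic kernel exactly marginal (`rescaled_const`, `rescaled_sq`).

NOT HERE (honest): WHICH functional of print has WHICH kernel, that print's terms ARE transversal ∕ reflection-even ∕ `C⁴` with WHICH
`K₄` on WHICH ball (the (A3) ∕ (A1c) readings; by R-AHL-g83-1 (c) the subtraction lives in [B12] (1.19)–(1.22) ∕ §5, the G-an2-4 ∕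
(D1) ∕ (D4) neighbourhood of the wall; IN SHAPE the momentum-smoothness letter `K₄` of an inherited kernel is LOCALITY of the term — the
fourth moment of its position-space kernel, finite by a tree decay `e^{−κd}` —, while a field-space Cauchy letter `(M, δ)` SIZES the kernel;
neither junction is typed here), and the letter `a_min ≤ a_k` BY VALUE — in print the running coupling staying small uniformly in
`k`, i.e. the β-flow (BetaPertH ⇐ (D1) ∧ (D4) ∧ CAP+tail): DISPLAYED here, discharged nowhere; the dimension-two rescaling is posited as
the shape of a mass-dimension-two insertion in `d = 4`, not derived from a lattice action; lattice-anisotropic marginal parts (only the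
multiple of the main form is absorbed in §6 — any other quadratic part must be carried as a remainder with its own letter); §3–§4 take
GLOBAL `Cᴺ` letters (the `ContDiffOn`-along-rays-inside-the-ball variants are routine, not typed).  BY-NAME EFFECT
ON THE WALL: NONE (suppliers and bookkeeping for a displayed letter).  NE7b NOT PRINTED ∕ NOT PROVED; spine PROVED 0∕9; rung (B)+1 on a
FINITE torus — NOT infinite volume, NOT the mass gap, NOT Clay.  HONEST DEPENDENCY: continuum YM on T⁴ ⇐ BetaPertH ∧ nine spine estimates
(0∕9 proved); BetaPertH ⇐ (D1) ∧ (D4) ∧ CAP+tail; G-an2-4 gates asym, D1 and NE2∕3∕4.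
-/

namespace Summit.QuantumFields.BalabanUV.T4Continuum.NE7b.InheritedHessianPowerCounting

open Set Filter Topology

noncomputable section

variable {E : Type*} [NormedAddCommGroup E] [NormedSpace ℝ E]
variable {G : Type*} [NormedAddCommGroup G] [NormedSpace ℝ G]

/-! ## §1 Transversality kills the mass term -/

/-- **TRANSVERSALITY KILLS THE MASS TERM** [folklore]: a kernel `Φ : E → (E →L[ℝ] G)`, continuous at the origin, for which the
longitudinal direction is a zero mode at every momentum (`Φ p p = 0`, the Ward identity in shape) VANISHES at zero momentum:
`Φ 0 = 0` — no polarisation has a mass term.  Proof: `Φ(t•v)v = 0` for `t ≠ 0`, let `t → 0`. -/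
theorem apply_zero_eq_zero_of_transversal {Φ : E → E →L[ℝ] G} (hc : ContinuousAt Φ 0)
    (hW : ∀ p, Φ p p = 0) : Φ 0 = 0 := by
  ext v
  have h1 : Tendsto (fun t : ℝ => Φ (t • v) v) (𝓝[≠] 0) (𝓝 (Φ 0 v)) := by
    have hsm : Tendsto (fun t : ℝ => t • v) (𝓝 0) (𝓝 0) := by
      simpa using (tendsto_id (x := 𝓝 (0 : ℝ))).smul (tendsto_const_nhds (x := v))
    have h2 : Tendsto (fun t : ℝ => Φ (t • v)) (𝓝 0) (𝓝 (Φ 0)) := hc.tendsto.comp hsm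
    exact (((ContinuousLinearMap.apply ℝ G v).continuous.tendsto _).comp h2).mono_left
      nhdsWithin_le_nhds
  have h3 : ∀ᶠ t : ℝ in 𝓝[≠] 0, Φ (t • v) v = 0 := by
    refine eventually_nhdsWithin_of_forall fun t ht => ?_
    have h := hW (t • v)
    rw [map_smul] at h
    have h' := inv_smul_smul₀ (mem_compl_singleton_iff.1 ht) (Φ (t • v) v)
    rw [h, smul_zero] at h'
    exact h'.symm
  have h4 : Tendsto (fun _ : ℝ => (0 : G)) (𝓝[≠] (0 : ℝ)) (𝓝 (Φ 0 v)) := h1.congr' h3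
  simpa using tendsto_nhds_unique h4 tendsto_const_nhds

/-! ## §2 Reflection symmetry kills the odd orders (one real variable) -/

/-- In a real normed space, `x = -x` forces `x = 0` (no `NoZeroSMulDivisors` instance is assumed; halving by hand). -/
theorem eq_zero_of_eq_neg_self {x : G} (h : x = -x) : x = 0 := by
  have h2 : x + x = 0 := by
    nth_rewrite 2 [h]
    exact add_neg_cancel x
  calc x = (2 : ℝ)⁻¹ • ((2 : ℝ) • x) := by rw [smul_smul, inv_mul_cancel₀ two_ne_zero, one_smul]
    _ = 0 := by rw [two_smul, h2, smul_zero]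

/-- **EVEN ⟹ ODD DERIVATIVES VANISH AT `0`** [folklore]: for `g : ℝ → G` with `g(−t) = g(t)` and `n` odd, `g⁽ⁿ⁾(0) = 0`
(Mathlib's `iteratedDeriv_comp_neg`: `(g ∘ neg)⁽ⁿ⁾(a) = (−1)ⁿ g⁽ⁿ⁾(−a)`).  No differentiability hypothesis is needed (Mathlib's
`iteratedDeriv` of a non-differentiable function is `0`). -/
theorem iteratedDeriv_eq_zero_of_even_of_odd {g : ℝ → G} (hg : ∀ t, g (-t) = g t) {n : ℕ} (hn : Odd n) :
    iteratedDeriv n g 0 = 0 := by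
  have h := iteratedDeriv_comp_neg n g 0
  have hfun : (fun x => g (-x)) = g := funext hg
  rw [hfun, neg_zero, hn.neg_one_pow, neg_one_smul] at h
  exact eq_zero_of_eq_neg_self h

/-- The first derivative of an even function vanishes at `0`. -/
theorem deriv_eq_zero_of_even {g : ℝ → G} (hg : ∀ t, g (-t) = g t) : deriv g 0 = 0 := by
  simpa using iteratedDeriv_eq_zero_of_even_of_odd hg odd_one

/-! ## §3 The ray letters: Taylor at `0` along `[0, 1]` -/

/-- Within-`[0,1]` iterated derivatives of a `Cᴺ` function agree with the global ones (`n ≤ N`). -/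
theorem iteratedDerivWithin_Icc_eq {g : ℝ → G} {N n : ℕ} (hg : ContDiff ℝ N g) (hn : n ≤ N) {t : ℝ}
    (ht : t ∈ Icc (0 : ℝ) 1) : iteratedDerivWithin n g (Icc 0 1) t = iteratedDeriv n g t :=
  iteratedDerivWithin_eq_iteratedDeriv (uniqueDiffOn_Icc zero_lt_one)
    (hg.contDiffAt.of_le (by exact_mod_cast hn)) ht

/-- **THE MARGINAL RAY LETTER** [folklore]: `g ∈ C²`, even, `g 0 = 0`, `‖g″‖ ≤ M₂` on `[0,1]` ⟹ `‖g 1‖ ≤ M₂` (Taylor to first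
order at `0`: the constant term vanishes by hypothesis, the linear term by evenness; the sharp constant `M₂∕2` is not needed). -/
theorem norm_le_of_even {g : ℝ → G} {M₂ : ℝ} (hg : ContDiff ℝ 2 g) (heven : ∀ t, g (-t) = g t) (h0 : g 0 = 0)
    (hM : ∀ t ∈ Icc (0 : ℝ) 1, ‖iteratedDeriv 2 g t‖ ≤ M₂) : ‖g 1‖ ≤ M₂ := by
  have hf : ContDiffOn ℝ (1 + 1) g (Icc 0 1) := by norm_num; exact hg.contDiffOn
  have hC : ∀ y ∈ Icc (0 : ℝ) 1, ‖iteratedDerivWithin (1 + 1) g (Icc 0 1) y‖ ≤ M₂ := fun y hy => by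
    rw [iteratedDerivWithin_Icc_eq (N := 2) hg le_rfl hy]; exact hM y hy
  have hT := taylor_mean_remainder_bound (f := g) (n := 1) (x := 1) zero_le_one hf
    (right_mem_Icc.2 zero_le_one) hC
  have hw1 : iteratedDerivWithin 1 g (Icc 0 1) 0 = iteratedDeriv 1 g 0 :=
    iteratedDerivWithin_Icc_eq (N := 2) hg one_le_two (left_mem_Icc.2 zero_le_one)
  have hD1 : iteratedDeriv 1 g 0 = 0 := iteratedDeriv_eq_zero_of_even_of_odd heven odd_one
  have hev : taylorWithinEval g 1 (Icc 0 1) 0 1 = 0 := by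
    simp [taylorWithinEval_succ, taylor_within_zero_eval, hw1, hD1, h0]
  rw [hev, sub_zero] at hT
  simpa using hT

/-- **THE SUBTRACTED RAY LETTER** [folklore]: `g ∈ C⁴`, even, `g 0 = 0`, `‖g⁗‖ ≤ M₄` on `[0,1]` ⟹
`‖g 1 − ½·g″(0)‖ ≤ M₄ ∕ 6` (Taylor to third order at `0`: the constant term vanishes by hypothesis, the odd terms by evenness, and
the quadratic term is what is subtracted; Mathlib's remainder constant `1∕3!`). -/
theorem norm_sub_half_iteratedDeriv_two_le_of_even {g : ℝ → G} {M₄ : ℝ} (hg : ContDiff ℝ 4 g)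
    (heven : ∀ t, g (-t) = g t) (h0 : g 0 = 0) (hM : ∀ t ∈ Icc (0 : ℝ) 1, ‖iteratedDeriv 4 g t‖ ≤ M₄) :
    ‖g 1 - (1 / 2 : ℝ) • iteratedDeriv 2 g 0‖ ≤ M₄ / 6 := by
  have hf : ContDiffOn ℝ (3 + 1) g (Icc 0 1) := hg.contDiffOn.of_le (by norm_num)
  have hC : ∀ y ∈ Icc (0 : ℝ) 1, ‖iteratedDerivWithin (3 + 1) g (Icc 0 1) y‖ ≤ M₄ := fun y hy => by
    rw [iteratedDerivWithin_Icc_eq (N := 4) hg le_rfl hy]; exact hM y hy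
  have hT := taylor_mean_remainder_bound (f := g) (n := 3) (x := 1) zero_le_one hf
    (right_mem_Icc.2 zero_le_one) hC
  have hw1 : iteratedDerivWithin 1 g (Icc 0 1) 0 = iteratedDeriv 1 g 0 :=
    iteratedDerivWithin_Icc_eq (N := 4) hg (by norm_num) (left_mem_Icc.2 zero_le_one)
  have hw2 : iteratedDerivWithin 2 g (Icc 0 1) 0 = iteratedDeriv 2 g 0 :=
    iteratedDerivWithin_Icc_eq (N := 4) hg (by norm_num) (left_mem_Icc.2 zero_le_one)
  have hw3 : iteratedDerivWithin 3 g (Icc 0 1) 0 = iteratedDeriv 3 g 0 :=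
    iteratedDerivWithin_Icc_eq (N := 4) hg (by norm_num) (left_mem_Icc.2 zero_le_one)
  have hD1 : iteratedDeriv 1 g 0 = 0 := iteratedDeriv_eq_zero_of_even_of_odd heven odd_one
  have hD3 : iteratedDeriv 3 g 0 = 0 := iteratedDeriv_eq_zero_of_even_of_odd heven (by decide)
  have hev : taylorWithinEval g 3 (Icc 0 1) 0 1 = (1 / 2 : ℝ) • iteratedDeriv 2 g 0 := by
    simp [taylorWithinEval_succ, taylor_within_zero_eval, hw1, hw2, hw3, hD1, hD3, h0]
    norm_num
  rw [hev] at hT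
  simpa [Nat.factorial] using hT

/-! ## §4 The kernel letters: several variables, along rays -/

/-- **THE RAY IS THE KERNEL ALONG A LINE**: for `Φ ∈ Cᴺ` and `n ≤ N`, the `n`-th derivative of `t ↦ Φ(t•p)` at `t` is
`DⁿΦ(t•p)[p,…,p]` (Mathlib's `ContinuousLinearMap.iteratedFDeriv_comp_right` with the line `toSpanSingleton ℝ p`). -/
theorem iteratedDeriv_ray {Φ : E → G} {N n : ℕ} (hΦ : ContDiff ℝ N Φ) (hn : n ≤ N) (p : E) (t : ℝ) :
    iteratedDeriv n (fun s : ℝ => Φ (s • p)) t = iteratedFDeriv ℝ n Φ (t • p) fun _ => p := by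
  have hfun : (fun s : ℝ => Φ (s • p)) = Φ ∘ ⇑(ContinuousLinearMap.toSpanSingleton ℝ p) := by
    funext s; simp
  rw [iteratedDeriv_eq_iteratedFDeriv, hfun,
    ContinuousLinearMap.iteratedFDeriv_comp_right _ hΦ t (by exact_mod_cast hn),
    ContinuousMultilinearMap.compContinuousLinearMap_apply]
  simp

/-- The ray of a `Cᴺ` kernel is `Cᴺ`. -/
theorem contDiff_ray {Φ : E → G} {N : ℕ} (hΦ : ContDiff ℝ N Φ) (p : E) :
    ContDiff ℝ N fun s : ℝ => Φ (s • p) :=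
  hΦ.comp (ContinuousLinearMap.toSpanSingleton ℝ p).contDiff

/-- Along the ray inside the ball: for `‖p‖ ≤ ρ`, `t ∈ [0,1]` and a letter `‖DⁿΦ q‖ ≤ K` on `closedBall 0 ρ`,
`‖DⁿΦ(t•p)[p,…,p]‖ ≤ K‖p‖ⁿ`. -/
theorem norm_iteratedFDeriv_ray_le {Φ : E → G} {n : ℕ} {K ρ : ℝ}
    (hK : ∀ q ∈ Metric.closedBall (0 : E) ρ, ‖iteratedFDeriv ℝ n Φ q‖ ≤ K) {p : E} (hp : ‖p‖ ≤ ρ)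
    {t : ℝ} (ht : t ∈ Icc (0 : ℝ) 1) : ‖iteratedFDeriv ℝ n Φ (t • p) fun _ => p‖ ≤ K * ‖p‖ ^ n := by
  have htp : t • p ∈ Metric.closedBall (0 : E) ρ := by
    rw [mem_closedBall_zero_iff, norm_smul, Real.norm_eq_abs, abs_of_nonneg ht.1]
    calc t * ‖p‖ ≤ 1 * ‖p‖ := by gcongr; exact ht.2
      _ ≤ ρ := by rw [one_mul]; exact hp
  calc ‖iteratedFDeriv ℝ n Φ (t • p) fun _ => p‖ ≤ ‖iteratedFDeriv ℝ n Φ (t • p)‖ * ∏ _i : Fin n, ‖p‖ :=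
        ContinuousMultilinearMap.le_opNorm _ _
    _ ≤ K * ‖p‖ ^ n := by
        rw [Finset.prod_const, Finset.card_univ, Fintype.card_fin]
        gcongr
        exact hK _ htp

/-- **THE MARGINAL KERNEL LETTER** [folklore]: `Φ ∈ C²` even with `Φ 0 = 0` (§1) and `‖D²Φ‖ ≤ K₂` on `closedBall 0 ρ` ⟹
`‖Φ p‖ ≤ K₂‖p‖²` for `‖p‖ ≤ ρ` — no constant and no linear term: the kernel is `O(‖p‖²)`, the power counting of a MARGINAL insertion. -/
theorem norm_le_of_iteratedFDeriv_two_le {Φ : E → G} {K₂ ρ : ℝ} (hΦ : ContDiff ℝ 2 Φ) (heven : ∀ q, Φ (-q) = Φ q)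
    (h0 : Φ 0 = 0) (hK : ∀ q ∈ Metric.closedBall (0 : E) ρ, ‖iteratedFDeriv ℝ 2 Φ q‖ ≤ K₂) {p : E} (hp : ‖p‖ ≤ ρ) :
    ‖Φ p‖ ≤ K₂ * ‖p‖ ^ 2 := by
  have h := norm_le_of_even (g := fun s : ℝ => Φ (s • p)) (M₂ := K₂ * ‖p‖ ^ 2) (contDiff_ray hΦ p)
    (fun t => by simp [neg_smul, heven]) (by simpa using h0) fun t ht => by
      rw [iteratedDeriv_ray hΦ le_rfl p t]; exact norm_iteratedFDeriv_ray_le hK hp ht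
  simpa using h

/-- **THE SUBTRACTED KERNEL LETTER** [folklore]: `Φ ∈ C⁴` even with `Φ 0 = 0` and `‖D⁴Φ‖ ≤ K₄` on `closedBall 0 ρ` ⟹ for `‖p‖ ≤ ρ`
`‖Φ p − ½·D²Φ(0)[p,p]‖ ≤ (K₄∕6)‖p‖⁴` — once the quadratic (marginal) part is subtracted the kernel is `O(‖p‖⁴)`, the power counting
of an IRRELEVANT insertion. -/
theorem norm_sub_half_hessian_le_of_iteratedFDeriv_four_le {Φ : E → G} {K₄ ρ : ℝ} (hΦ : ContDiff ℝ 4 Φ)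
    (heven : ∀ q, Φ (-q) = Φ q) (h0 : Φ 0 = 0)
    (hK : ∀ q ∈ Metric.closedBall (0 : E) ρ, ‖iteratedFDeriv ℝ 4 Φ q‖ ≤ K₄) {p : E} (hp : ‖p‖ ≤ ρ) :
    ‖Φ p - (1 / 2 : ℝ) • iteratedFDeriv ℝ 2 Φ 0 (fun _ => p)‖ ≤ K₄ / 6 * ‖p‖ ^ 4 := by
  have h := norm_sub_half_iteratedDeriv_two_le_of_even (g := fun s : ℝ => Φ (s • p)) (M₄ := K₄ * ‖p‖ ^ 4)
    (contDiff_ray hΦ p) (fun t => by simp [neg_smul, heven]) (by simpa using h0) fun t ht => by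
      rw [iteratedDeriv_ray hΦ le_rfl p t]; exact norm_iteratedFDeriv_ray_le hK hp ht
  rw [iteratedDeriv_ray hΦ (by norm_num) p 0, zero_smul, one_smul] at h
  calc _ ≤ K₄ * ‖p‖ ^ 4 / 6 := h
    _ = K₄ / 6 * ‖p‖ ^ 4 := by ring

/-! ## §5 The dimension-two rescaling and the three regimes -/

/-- **THE RESCALED LETTER** [folklore bookkeeping]: if `‖Φ q‖ ≤ C‖q‖ᵐ` on `‖q‖ ≤ ρ` and `L ≥ 1`, the age-`n` letter
`(Lⁿ)² • Φ((Lⁿ)⁻¹ • p)` is bounded by `C‖p‖ᵐ·(Lⁿ)²∕(Lⁿ)ᵐ` for `‖p‖ ≤ ρ`: degree `m < 2` RELEVANT, `m = 2` MARGINAL, `m > 2` IRRELEVANT. -/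
theorem norm_rescaled_le {Φ : E → G} {C ρ L : ℝ} {m : ℕ} (hL : 1 ≤ L)
    (hΦ : ∀ q : E, ‖q‖ ≤ ρ → ‖Φ q‖ ≤ C * ‖q‖ ^ m) (n : ℕ) {p : E} (hp : ‖p‖ ≤ ρ) :
    ‖(L ^ n) ^ 2 • Φ ((L ^ n)⁻¹ • p)‖ ≤ C * ‖p‖ ^ m * ((L ^ n) ^ 2 / (L ^ n) ^ m) := by
  have hLn : 0 < L ^ n := pow_pos (by linarith) n
  have hq : ‖(L ^ n)⁻¹ • p‖ = (L ^ n)⁻¹ * ‖p‖ := by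
    rw [norm_smul, Real.norm_eq_abs, abs_inv, abs_of_pos hLn]
  have hqρ : ‖(L ^ n)⁻¹ • p‖ ≤ ρ := by
    rw [hq]
    calc (L ^ n)⁻¹ * ‖p‖ ≤ 1 * ‖p‖ := by
          gcongr; exact inv_le_one_of_one_le₀ (one_le_pow₀ hL)
      _ ≤ ρ := by rw [one_mul]; exact hp
  calc ‖(L ^ n) ^ 2 • Φ ((L ^ n)⁻¹ • p)‖ = (L ^ n) ^ 2 * ‖Φ ((L ^ n)⁻¹ • p)‖ := by
        rw [norm_smul, Real.norm_eq_abs, abs_of_pos (pow_pos hLn 2)]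
    _ ≤ (L ^ n) ^ 2 * (C * ‖(L ^ n)⁻¹ • p‖ ^ m) := by gcongr; exact hΦ _ hqρ
    _ = C * ‖p‖ ^ m * ((L ^ n) ^ 2 / (L ^ n) ^ m) := by rw [hq, mul_pow, inv_pow]; ring

/-- **MARGINAL**: a kernel `O(‖q‖²)` gives the SAME letter `C‖p‖²` at every age — exact scale invariance of the bound. -/
theorem norm_rescaled_le_of_sq {Φ : E → G} {C ρ L : ℝ} (hL : 1 ≤ L)
    (hΦ : ∀ q : E, ‖q‖ ≤ ρ → ‖Φ q‖ ≤ C * ‖q‖ ^ 2) (n : ℕ) {p : E} (hp : ‖p‖ ≤ ρ) :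
    ‖(L ^ n) ^ 2 • Φ ((L ^ n)⁻¹ • p)‖ ≤ C * ‖p‖ ^ 2 := by
  have h := norm_rescaled_le hL hΦ n hp
  have hLn : (L ^ n) ^ 2 ≠ 0 := pow_ne_zero 2 (pow_ne_zero n (by linarith))
  rwa [div_self hLn, mul_one] at h

/-- **MARGINAL, SUMMED**: `k + 1` inherited marginal kernels give `(k + 1)·C‖p‖²` — linear in the number of scales (the logarithm
of the cutoff): NOT uniform in `k`; this is what the `β`-counter-terms must absorb (§6). -/
theorem sum_norm_rescaled_le_of_sq {Φ : ℕ → E → G} {C ρ L : ℝ} (hL : 1 ≤ L)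
    (hΦ : ∀ n, ∀ q : E, ‖q‖ ≤ ρ → ‖Φ n q‖ ≤ C * ‖q‖ ^ 2) (k : ℕ) {p : E} (hp : ‖p‖ ≤ ρ) :
    ∑ n ∈ Finset.range (k + 1), ‖(L ^ n) ^ 2 • Φ n ((L ^ n)⁻¹ • p)‖ ≤ (k + 1) * (C * ‖p‖ ^ 2) := by
  calc ∑ n ∈ Finset.range (k + 1), ‖(L ^ n) ^ 2 • Φ n ((L ^ n)⁻¹ • p)‖
      ≤ ∑ _n ∈ Finset.range (k + 1), C * ‖p‖ ^ 2 :=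
        Finset.sum_le_sum fun n _ => norm_rescaled_le_of_sq hL (hΦ n) n hp
    _ = (k + 1) * (C * ‖p‖ ^ 2) := by simp

/-- **IRRELEVANT**: a kernel `O(‖q‖⁴)` on `‖q‖ ≤ ρ` gives at age `n` the letter `C ρ² ‖p‖² ∕ (L²)ⁿ` (`0 ≤ C`) — two powers of `p`
are traded for the window radius squared, the other two for the geometric gain. -/
theorem norm_rescaled_le_of_fourth {Φ : E → G} {C ρ L : ℝ} (hL : 1 ≤ L) (hC : 0 ≤ C)
    (hΦ : ∀ q : E, ‖q‖ ≤ ρ → ‖Φ q‖ ≤ C * ‖q‖ ^ 4) (n : ℕ) {p : E} (hp : ‖p‖ ≤ ρ) :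
    ‖(L ^ n) ^ 2 • Φ ((L ^ n)⁻¹ • p)‖ ≤ C * ρ ^ 2 * ‖p‖ ^ 2 / (L ^ 2) ^ n := by
  have h := norm_rescaled_le hL hΦ n hp
  have hLn : 0 < L ^ n := pow_pos (by linarith) n
  have hρ : 0 ≤ ρ := (norm_nonneg p).trans hp
  calc ‖(L ^ n) ^ 2 • Φ ((L ^ n)⁻¹ • p)‖ ≤ C * ‖p‖ ^ 4 * ((L ^ n) ^ 2 / (L ^ n) ^ 4) := h
    _ = C * ‖p‖ ^ 2 * ‖p‖ ^ 2 / (L ^ 2) ^ n := by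
        rw [← pow_mul, ← pow_mul]
        field_simp
        ring
    _ ≤ C * ρ ^ 2 * ‖p‖ ^ 2 / (L ^ 2) ^ n := by
        gcongr

/-- **IRRELEVANT, SUMMED — UNIFORM IN `k`** [folklore]: inherited kernels `Φₙ = O(‖q‖⁴)` with a COMMON letter `C ≥ 0` on `‖q‖ ≤ ρ`
and `L > 1` give `Σ_{n ≤ k} ‖(Lⁿ)²Φₙ((Lⁿ)⁻¹p)‖ ≤ C ρ² (L²∕(L² − 1)) ‖p‖²` for EVERY `k` (Mathlib's `geom_sum_Ico_le_of_lt_one`). -/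
theorem sum_norm_rescaled_le_of_fourth {Φ : ℕ → E → G} {C ρ L : ℝ} (hL : 1 < L) (hC : 0 ≤ C)
    (hΦ : ∀ n, ∀ q : E, ‖q‖ ≤ ρ → ‖Φ n q‖ ≤ C * ‖q‖ ^ 4) (k : ℕ) {p : E} (hp : ‖p‖ ≤ ρ) :
    ∑ n ∈ Finset.range (k + 1), ‖(L ^ n) ^ 2 • Φ n ((L ^ n)⁻¹ • p)‖
      ≤ C * ρ ^ 2 * (L ^ 2 / (L ^ 2 - 1)) * ‖p‖ ^ 2 := by
  have hL2 : 1 < L ^ 2 := by nlinarith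
  have hx0 : 0 ≤ (L ^ 2)⁻¹ := inv_nonneg.2 (by positivity)
  have hx1 : (L ^ 2)⁻¹ < 1 := inv_lt_one_of_one_lt₀ hL2
  have hgeom : ∑ n ∈ Finset.range (k + 1), ((L ^ 2)⁻¹) ^ n ≤ L ^ 2 / (L ^ 2 - 1) := by
    have h := geom_sum_Ico_le_of_lt_one (m := 0) (n := k + 1) hx0 hx1
    rw [pow_zero, ← Finset.range_eq_Ico] at h
    refine h.trans (le_of_eq ?_)
    have hne : L ^ 2 - 1 ≠ 0 := by linarith
    have hne' : L ^ 2 ≠ 0 := by positivity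
    field_simp
  calc ∑ n ∈ Finset.range (k + 1), ‖(L ^ n) ^ 2 • Φ n ((L ^ n)⁻¹ • p)‖
      ≤ ∑ n ∈ Finset.range (k + 1), C * ρ ^ 2 * ‖p‖ ^ 2 * ((L ^ 2)⁻¹) ^ n := by
        refine Finset.sum_le_sum fun n _ => ?_
        have h := norm_rescaled_le_of_fourth hL.le hC (hΦ n) n hp
        rwa [inv_pow, ← div_eq_mul_inv]
    _ = C * ρ ^ 2 * ‖p‖ ^ 2 * ∑ n ∈ Finset.range (k + 1), ((L ^ 2)⁻¹) ^ n := by rw [Finset.mul_sum]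
    _ ≤ C * ρ ^ 2 * ‖p‖ ^ 2 * (L ^ 2 / (L ^ 2 - 1)) := by
        have : 0 ≤ C * ρ ^ 2 * ‖p‖ ^ 2 := by positivity
        exact mul_le_mul_of_nonneg_left hgeom this
    _ = C * ρ ^ 2 * (L ^ 2 / (L ^ 2 - 1)) * ‖p‖ ^ 2 := by ring

/-! ## §6 The renormalised floor (scalar currency) -/

/-- **THE MARGINAL PARTS RENORMALISE THE COEFFICIENT** [folklore bookkeeping]: if every inherited kernel splits as `bₙ·m + Rₙ`
with `m` 2-homogeneous, then under the dimension-two rescaling the marginal parts come back as `bₙ·m(p)` EXACTLY and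
`a₀·m(p) + Σ_{n≤k} (Lⁿ)²Φₙ((Lⁿ)⁻¹p) = (a₀ + Σ_{n≤k} bₙ)·m(p) + Σ_{n≤k} (Lⁿ)²Rₙ((Lⁿ)⁻¹p)` — the running coefficient in shape. -/
theorem sum_rescaled_split {m : E → ℝ} {Φ R : ℕ → E → ℝ} {b : ℕ → ℝ} {L : ℝ} (hL : L ≠ 0)
    (hm : ∀ (c : ℝ) (q : E), m (c • q) = c ^ 2 * m q) (hsplit : ∀ n q, Φ n q = b n * m q + R n q)
    (a₀ : ℝ) (k : ℕ) (p : E) :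
    a₀ * m p + ∑ n ∈ Finset.range (k + 1), (L ^ n) ^ 2 * Φ n ((L ^ n)⁻¹ • p)
      = (a₀ + ∑ n ∈ Finset.range (k + 1), b n) * m p
        + ∑ n ∈ Finset.range (k + 1), (L ^ n) ^ 2 * R n ((L ^ n)⁻¹ • p) := by
  have hterm : ∀ n, (L ^ n) ^ 2 * Φ n ((L ^ n)⁻¹ • p) = b n * m p + (L ^ n) ^ 2 * R n ((L ^ n)⁻¹ • p) := by
    intro n
    have hLn : (L ^ n) ^ 2 ≠ 0 := pow_ne_zero 2 (pow_ne_zero n hL)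
    rw [hsplit, hm, mul_add, inv_pow]
    field_simp
  simp_rw [hterm, Finset.sum_add_distrib, add_mul, Finset.sum_mul]
  ring

/-- **THE RENORMALISED FLOOR, UNIFORM IN `k`** [folklore]: main form `m` with `μ‖p‖² ≤ m(p)` (`0 ≤ μ`), running coefficient with the
DISPLAYED letter `a_min ≤ a k` (`0 ≤ a_min` — in print: the running coupling stays small uniformly in `k`, the β-flow; displayed, not
discharged), subtracted inherited remainders `|Rₙ q| ≤ C‖q‖⁴` on `‖q‖ ≤ ρ` (`0 ≤ C`), `L > 1`: for every `k` and every `‖p‖ ≤ ρ`,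
`(a_min·μ − C ρ² L²∕(L²−1))·‖p‖² ≤ a k·m(p) + Σ_{n≤k} (Lⁿ)² Rₙ((Lⁿ)⁻¹ p)` — positive as soon as the window radius `ρ` is small
against `a_min μ`. -/
theorem floor_uniform_of_running_coefficient {m : E → ℝ} {R : ℕ → E → ℝ} {a : ℕ → ℝ} {amin μ C ρ L : ℝ}
    (hL : 1 < L) (hC : 0 ≤ C) (hμ : 0 ≤ μ) (hm : ∀ p, μ * ‖p‖ ^ 2 ≤ m p) (hamin : 0 ≤ amin) (ha : ∀ k, amin ≤ a k)
    (hR : ∀ n, ∀ q : E, ‖q‖ ≤ ρ → |R n q| ≤ C * ‖q‖ ^ 4) (k : ℕ) {p : E} (hp : ‖p‖ ≤ ρ) :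
    (amin * μ - C * ρ ^ 2 * (L ^ 2 / (L ^ 2 - 1))) * ‖p‖ ^ 2
      ≤ a k * m p + ∑ n ∈ Finset.range (k + 1), (L ^ n) ^ 2 * R n ((L ^ n)⁻¹ • p) := by
  have hmp : 0 ≤ m p := le_trans (by positivity) (hm p)
  have hmain : amin * μ * ‖p‖ ^ 2 ≤ a k * m p :=
    calc amin * μ * ‖p‖ ^ 2 = amin * (μ * ‖p‖ ^ 2) := by ring
      _ ≤ amin * m p := by gcongr; exact hm p
      _ ≤ a k * m p := by gcongr; exact ha k
  have hsum : ∑ n ∈ Finset.range (k + 1), ‖(L ^ n) ^ 2 • R n ((L ^ n)⁻¹ • p)‖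
      ≤ C * ρ ^ 2 * (L ^ 2 / (L ^ 2 - 1)) * ‖p‖ ^ 2 :=
    sum_norm_rescaled_le_of_fourth (G := ℝ) hL hC (fun n q hq => by
      rw [Real.norm_eq_abs]; exact hR n q hq) k hp
  have hlow : -(C * ρ ^ 2 * (L ^ 2 / (L ^ 2 - 1)) * ‖p‖ ^ 2)
      ≤ ∑ n ∈ Finset.range (k + 1), (L ^ n) ^ 2 * R n ((L ^ n)⁻¹ • p) := by
    rw [neg_le]
    calc -∑ n ∈ Finset.range (k + 1), (L ^ n) ^ 2 * R n ((L ^ n)⁻¹ • p)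
        = ∑ n ∈ Finset.range (k + 1), -((L ^ n) ^ 2 * R n ((L ^ n)⁻¹ • p)) := by rw [Finset.sum_neg_distrib]
      _ ≤ ∑ n ∈ Finset.range (k + 1), ‖(L ^ n) ^ 2 • R n ((L ^ n)⁻¹ • p)‖ :=
          Finset.sum_le_sum fun n _ => by
            rw [smul_eq_mul, Real.norm_eq_abs]; exact neg_le_abs _
      _ ≤ C * ρ ^ 2 * (L ^ 2 / (L ^ 2 - 1)) * ‖p‖ ^ 2 := hsum
  linarith

/-- **THE FLOOR FROM THE SPLIT**: §6's two theorems composed — inherited kernels `Φₙ = bₙ·m + Rₙ`, running coefficient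
`a k = a₀ + Σ_{n≤k} bₙ ≥ a_min ≥ 0` DISPLAYED for every `k`. -/
theorem floor_uniform_of_split {m : E → ℝ} {Φ R : ℕ → E → ℝ} {b : ℕ → ℝ} {a₀ amin μ C ρ L : ℝ}
    (hL : 1 < L) (hC : 0 ≤ C) (hμ : 0 ≤ μ) (hm : ∀ p, μ * ‖p‖ ^ 2 ≤ m p)
    (hm2 : ∀ (c : ℝ) (q : E), m (c • q) = c ^ 2 * m q) (hsplit : ∀ n q, Φ n q = b n * m q + R n q)
    (hamin : 0 ≤ amin) (ha : ∀ k, amin ≤ a₀ + ∑ n ∈ Finset.range (k + 1), b n)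
    (hR : ∀ n, ∀ q : E, ‖q‖ ≤ ρ → |R n q| ≤ C * ‖q‖ ^ 4) (k : ℕ) {p : E} (hp : ‖p‖ ≤ ρ) :
    (amin * μ - C * ρ ^ 2 * (L ^ 2 / (L ^ 2 - 1))) * ‖p‖ ^ 2
      ≤ a₀ * m p + ∑ n ∈ Finset.range (k + 1), (L ^ n) ^ 2 * Φ n ((L ^ n)⁻¹ • p) := by
  rw [sum_rescaled_split (by linarith) hm2 hsplit a₀ k p]
  exact floor_uniform_of_running_coefficient (a := fun k => a₀ + ∑ n ∈ Finset.range (k + 1), b n)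
    hL hC hμ hm hamin ha hR k hp

/-! ## §7 Toys: the constant kernel is exactly relevant, the quadratic kernel exactly marginal -/

/-- A constant kernel (a MASS TERM — no Ward identity) comes back at age `n` multiplied by `(Lⁿ)²` EXACTLY: relevant. -/
theorem rescaled_const (u : G) (L : ℝ) (n : ℕ) (p : E) :
    (L ^ n) ^ 2 • (fun _ : E => u) ((L ^ n)⁻¹ • p) = (L ^ n) ^ 2 • u := rfl

/-- A pure quadratic kernel `‖q‖² • u` comes back UNCHANGED at every age (`L ≠ 0`): exactly marginal. -/
theorem rescaled_sq (u : G) {L : ℝ} (hL : L ≠ 0) (n : ℕ) (p : E) :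
    (L ^ n) ^ 2 • (fun q : E => ‖q‖ ^ 2 • u) ((L ^ n)⁻¹ • p) = ‖p‖ ^ 2 • u := by
  have hLn : L ^ n ≠ 0 := pow_ne_zero n hL
  simp only [norm_smul, norm_inv, norm_pow, Real.norm_eq_abs, smul_smul]
  congr 1
  rw [← abs_pow, mul_pow, inv_pow, sq_abs]
  field_simp

end

end Summit.QuantumFields.BalabanUV.T4Continuum.NE7b.InheritedHessianPowerCounting
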